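import Literature.NumberTheory.EllipticCurves.Rank1Residual.X11RankOneCertificates.Minimality
import Literature.NumberTheory.EllipticCurves.RationalIsogenyFrobeniusCriterion
import Literature.NumberTheory.EllipticCurves.ComplexMultiplicationLocalFactorsAux
import Literature.NumberTheory.EllipticCurves.PAdicLFunction
import Summits.BirchSwinnertonDyer.Rank2.TwoIsogenyPlantedRankKernel
import HarnessLib

/-!
# p2's `8-15-17` family: the `a₁ = 1` model is globally minimal and good ordinary at `2` (cell `bsd-rank2`)

Cell `bsd-rank2` (D-0036), seat `bsd-rank2-lit` GEN 14, for planner p2 GEN 13's door (F*) (memo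
`run/shared/lean/pub/bsd-rank2/p2/PADIC-R2-G13.md` §3, sketch `p2/g13/routeF/Sketch.lean`, support item
`FamilyFacts` = K_F1: conjuncts «`IsGloballyMinimal (curve j n)`» and «`IsOrdinaryAt (curve j n) 2`»).
Companion of `Rank2/TwoIsogenyPlantedRankKernel.lean` (rank `≥ 2`, same family, same model).

PARTITION: none — r_an ≥ 2, summit axis S0; TWIN (D-0056): n/a. B1: member-wise minimal-model and
reduction-at-2 bookkeeping for an explicit family; no L-function, no Selmer group, no S0 motion.

## The model and the statements

`m`, `q = m + 64 n²`, `r = m + 289 n²` primes, `n ≠ 0`, `A ∈ ℤ` with `4A = −17q − 1` (so `q ≡ 3 (4)`);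
`W = ⟨1, A, 0, q r, 0⟩ : y² + xy = x³ + A x² + q r x` (p2's `curve j n`, `m = 8j + 3`). Then

* `Δ(W) = 225 · m · q³ · r²` (`family81517Int_Δ`; `b₂ = 1 + 4A = −17q`, `b₄ = 2qr`, `b₆ = 0`,
  `b₈ = −q²r²`, `Δ = 289 q⁴ r² − 64 q³ r³ = q³ r² (289 q − 64 r) = 225 m q³ r²`);
* for every prime `ℓ`, `v_ℓ(Δ) ≤ 10 < 12` (`not_pow_twelve_dvd_Δ_family81517`), so `W` is a GLOBAL MINIMAL
  MODEL by Silverman VII.1 Remark 1.1 / VIII.8 as packaged in the tree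
  (`isGloballyMinimal_of_int_criterion`): `isGloballyMinimal_family81517_model`; its tree integral model is
  `⟨1, A, 0, qr, 0⟩` and `Δ_min = 225 m q³ r²` (`integralModelInt_…`, `minimalDiscriminantInt_…`);
* `m, q, r` are odd, so `2 ∤ Δ_min`: GOOD reduction at `2` (tree `hasGoodReductionAtPrime_of_not_dvd`), and the
  reduction `y² + xy = x³ + ā x² + x` over `𝔽₂` has `2` points (`ā = 1`) or `4` points (`ā = 0`), so
  `a₂(W) = 3 − #W̃(𝔽₂) = ±1` is odd: `W` is ORDINARY at `2` (`isOrdinaryAt_two_family81517_model`).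

No named fact, no `sorry`. Template: `Literature/…/Zywina2025Torsion.lean` (same three steps for Zywina's
3-4-5 family).
-/

namespace Summit.BirchSwinnertonDyer.Rank2

open _root_.WeierstrassCurve
open Literature.NumberTheory.EllipticCurves
open Literature.NumberTheory.EllipticCurves.Rank1Residual.X11RankOneCertificates

section Family81517AtTwo

variable {m q r : ℕ} {n A : ℤ}

/-! ### The integer model and its discriminant -/

/-- `Δ(⟨1, A, 0, qr, 0⟩) = 225 m q³ r²` for `4A = −17q − 1`, `q = m + 64n²`, `r = m + 289n²`. [folklore] -/
theorem family81517Int_Δ (hq_eq : (q : ℤ) = m + 64 * n ^ 2) (hr_eq : (r : ℤ) = m + 289 * n ^ 2)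
    (hA : 4 * A = -17 * q - 1) :
    (⟨1, A, 0, (q : ℤ) * r, 0⟩ : WeierstrassCurve ℤ).Δ = 225 * m * (q : ℤ) ^ 3 * (r : ℤ) ^ 2 := by
  simp only [WeierstrassCurve.Δ, WeierstrassCurve.b₂, WeierstrassCurve.b₄, WeierstrassCurve.b₆,
    WeierstrassCurve.b₈]
  linear_combination (q : ℤ) ^ 2 * (r : ℤ) ^ 2 * (1 + 4 * A - 17 * q) * hA +
    (q : ℤ) ^ 3 * (r : ℤ) ^ 2 * (289 * hq_eq - 64 * hr_eq)

/-- The certificate schema's `discOf` of `[1, A, 0, qr, 0]` is `Δ(⟨1, A, 0, qr, 0⟩)`. [folklore] -/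
theorem discOf_family81517 (A b : ℤ) :
    discOf [1, A, 0, b, 0] = (⟨1, A, 0, b, 0⟩ : WeierstrassCurve ℤ).Δ := by
  simp only [discOf, invariants, WeierstrassCurve.Δ, WeierstrassCurve.b₂, WeierstrassCurve.b₄,
    WeierstrassCurve.b₆, WeierstrassCurve.b₈]
  ring

/-- The rational model with all coefficients as integer casts. [folklore] -/
theorem family81517_model_eq_intCast (A : ℤ) (q r : ℕ) :
    (⟨1, (A : ℚ), 0, (((q : ℤ) * r : ℤ) : ℚ), 0⟩ : WeierstrassCurve ℚ) =
      ⟨((1 : ℤ) : ℚ), ((A : ℤ) : ℚ), ((0 : ℤ) : ℚ), (((q : ℤ) * r : ℤ) : ℚ), ((0 : ℤ) : ℚ)⟩ := by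
  ext <;> simp

/-- The rational model is the base change of the integer model. [folklore] -/
theorem family81517Int_baseChange (A : ℤ) (q r : ℕ) :
    (⟨1, A, 0, (q : ℤ) * r, 0⟩ : WeierstrassCurve ℤ).baseChange ℚ =
      ⟨1, (A : ℚ), 0, (((q : ℤ) * r : ℤ) : ℚ), 0⟩ := by
  rw [baseChange_int_eq_map]
  ext <;> simp [WeierstrassCurve.map]

/-! ### Parities and sizes of the parameters -/

/-- `q` and `r` are odd primes `> 5`, `m` is odd, and `m ≠ q`, `q ≠ r`, `m ≠ r`. [folklore] -/
theorem family81517_odd (hm : m.Prime) (hq : q.Prime) (hr : r.Prime) (hn : n ≠ 0)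
    (hq_eq : (q : ℤ) = m + 64 * n ^ 2) (hr_eq : (r : ℤ) = m + 289 * n ^ 2) :
    m % 2 = 1 ∧ q % 2 = 1 ∧ r % 2 = 1 ∧ 5 < q ∧ 5 < r := by
  have hn2 : 1 ≤ n ^ 2 := by
    have : 0 < n ^ 2 := by positivity
    omega
  have hm2 : (2 : ℤ) ≤ m := by exact_mod_cast hm.two_le
  have hq66 : (66 : ℤ) ≤ q := by rw [hq_eq]; nlinarith
  have hr291 : (291 : ℤ) ≤ r := by rw [hr_eq]; nlinarith
  have hq66' : 66 ≤ q := by exact_mod_cast hq66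
  have hr291' : 291 ≤ r := by exact_mod_cast hr291
  have hqodd : q % 2 = 1 := by
    rcases hq.eq_two_or_odd with h | h
    · omega
    · exact h
  have hrodd : r % 2 = 1 := by
    rcases hr.eq_two_or_odd with h | h
    · omega
    · exact h
  have hmodd : m % 2 = 1 := by
    rcases hm.eq_two_or_odd with h | h
    · -- `m = 2` would make `q = 2 + 64 n²` even
      exfalso
      subst h
      have : (q : ℤ) % 2 = 0 := by rw [hq_eq]; omega
      omega
    · exact h
  exact ⟨hmodd, hqodd, hrodd, by omega, by omega⟩

/-! ### `ℓ¹² ∤ Δ` for every prime `ℓ` -/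

/-- `v_ℓ(s) ≤ 1` for primes `ℓ, s`. [folklore] -/
theorem padicValNat_prime_le_one {ℓ s : ℕ} [Fact ℓ.Prime] (hs : s.Prime) : padicValNat ℓ s ≤ 1 := by
  by_cases h : ℓ = s
  · subst h; rw [padicValNat_self]
  · haveI : Fact s.Prime := ⟨hs⟩
    rw [padicValNat_primes h]; exact zero_le_one

/-- For every prime `ℓ`, `ℓ¹² ∤ 225 m q³ r²` (`v_ℓ ≤ 2·1 + 2·1 + 1 + 3 + 2 = 10`). [folklore] -/
theorem not_pow_twelve_dvd_Δ_family81517 (hm : m.Prime) (hq : q.Prime) (hr : r.Prime) (ℓ : ℕ)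
    (hℓ : ℓ.Prime) : ¬ (ℓ : ℤ) ^ 12 ∣ 225 * m * (q : ℤ) ^ 3 * (r : ℤ) ^ 2 := by
  intro hdvd
  set N : ℕ := 3 ^ 2 * 5 ^ 2 * m * q ^ 3 * r ^ 2 with hN
  have hcast : (225 * m * (q : ℤ) ^ 3 * (r : ℤ) ^ 2) = (N : ℤ) := by rw [hN]; push_cast; ring
  rw [hcast, ← Int.natCast_pow, Int.natCast_dvd_natCast] at hdvd
  haveI : Fact ℓ.Prime := ⟨hℓ⟩
  have hN0 : N ≠ 0 := by
    rw [hN]; have := hm.pos; have := hq.pos; have := hr.pos; positivity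
  have hv : 12 ≤ padicValNat ℓ N := (padicValNat_dvd_iff_le hN0).mp hdvd
  have hvN : padicValNat ℓ N = 2 * padicValNat ℓ 3 + 2 * padicValNat ℓ 5 + padicValNat ℓ m +
      3 * padicValNat ℓ q + 2 * padicValNat ℓ r := by
    have := hm.pos; have := hq.pos; have := hr.pos
    rw [hN, padicValNat.mul (by positivity) (by positivity),
      padicValNat.mul (by positivity) (by positivity), padicValNat.mul (by positivity) (by positivity),
      padicValNat.mul (by positivity) (by positivity), padicValNat.pow, padicValNat.pow,
      padicValNat.pow, padicValNat.pow]
  have h3 := padicValNat_prime_le_one (ℓ := ℓ) Nat.prime_three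
  have h5 := padicValNat_prime_le_one (ℓ := ℓ) Nat.prime_five
  have h1 := padicValNat_prime_le_one (ℓ := ℓ) hm
  have h2 := padicValNat_prime_le_one (ℓ := ℓ) hq
  have h4 := padicValNat_prime_le_one (ℓ := ℓ) hr
  omega

/-! ### Global minimality, the integral model, the minimal discriminant -/

/-- **The `a₁ = 1` model `⟨1, A, 0, qr, 0⟩` of p2's family is a global minimal model.**
[folklore: Silverman AEC VII.1 Remark 1.1, VIII.8] -/
theorem isGloballyMinimal_family81517_model (hm : m.Prime) (hq : q.Prime) (hr : r.Prime)
    (hq_eq : (q : ℤ) = m + 64 * n ^ 2) (hr_eq : (r : ℤ) = m + 289 * n ^ 2) (hA : 4 * A = -17 * q - 1) :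
    (⟨1, (A : ℚ), 0, (((q : ℤ) * r : ℤ) : ℚ), 0⟩ : WeierstrassCurve ℚ).IsGloballyMinimal := by
  rw [family81517_model_eq_intCast]
  refine isGloballyMinimal_of_int_criterion _ _ _ _ _ fun ℓ hℓ hboth => ?_
  have h12 := hboth.1
  rw [discOf_family81517, family81517Int_Δ hq_eq hr_eq hA] at h12
  exact not_pow_twelve_dvd_Δ_family81517 hm hq hr ℓ hℓ h12

/-- The tree's integral model of the `a₁ = 1` model is `⟨1, A, 0, qr, 0⟩` itself. [folklore] -/
theorem integralModelInt_family81517_model (hm : m.Prime) (hq : q.Prime) (hr : r.Prime)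
    (hq_eq : (q : ℤ) = m + 64 * n ^ 2) (hr_eq : (r : ℤ) = m + 289 * n ^ 2) (hA : 4 * A = -17 * q - 1) :
    haveI := isGloballyMinimal_family81517_model hm hq hr hq_eq hr_eq hA
    integralModelInt (⟨1, (A : ℚ), 0, (((q : ℤ) * r : ℤ) : ℚ), 0⟩ : WeierstrassCurve ℚ) =
      ⟨1, A, 0, (q : ℤ) * r, 0⟩ := by
  haveI := isGloballyMinimal_family81517_model hm hq hr hq_eq hr_eq hA
  have key : ∀ (X : WeierstrassCurve ℚ) [X.IsGloballyMinimal],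
      (⟨1, A, 0, (q : ℤ) * r, 0⟩ : WeierstrassCurve ℤ).baseChange ℚ = X →
        integralModelInt X = ⟨1, A, 0, (q : ℤ) * r, 0⟩ := by
    rintro X _ rfl
    exact integralModelInt_baseChange_int _
  exact key _ (family81517Int_baseChange A q r)

/-- The minimal discriminant of the `a₁ = 1` model is `225 m q³ r²`. [folklore] -/
theorem minimalDiscriminantInt_family81517_model (hm : m.Prime) (hq : q.Prime) (hr : r.Prime)
    (hq_eq : (q : ℤ) = m + 64 * n ^ 2) (hr_eq : (r : ℤ) = m + 289 * n ^ 2) (hA : 4 * A = -17 * q - 1) :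
    haveI := isGloballyMinimal_family81517_model hm hq hr hq_eq hr_eq hA
    minimalDiscriminantInt (⟨1, (A : ℚ), 0, (((q : ℤ) * r : ℤ) : ℚ), 0⟩ : WeierstrassCurve ℚ) =
      225 * m * (q : ℤ) ^ 3 * (r : ℤ) ^ 2 := by
  rw [minimalDiscriminantInt, integralModelInt_family81517_model hm hq hr hq_eq hr_eq hA,
    family81517Int_Δ hq_eq hr_eq hA]

/-! ### Good ordinary reduction at `2` -/

/-- `2 ∤ Δ_min = 225 m q³ r²`. [folklore] -/
theorem not_two_dvd_Δ_family81517 (hm : m.Prime) (hq : q.Prime) (hr : r.Prime) (hn : n ≠ 0)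
    (hq_eq : (q : ℤ) = m + 64 * n ^ 2) (hr_eq : (r : ℤ) = m + 289 * n ^ 2) :
    ¬ (2 : ℤ) ∣ 225 * m * (q : ℤ) ^ 3 * (r : ℤ) ^ 2 := by
  obtain ⟨hmo, hqo, hro, -, -⟩ := family81517_odd hm hq hr hn hq_eq hr_eq
  rw [← even_iff_two_dvd, ← Int.not_odd_iff_even, not_not]
  have hm' : Odd (m : ℤ) := by exact_mod_cast Nat.odd_iff.mpr hmo
  have hq' : Odd (q : ℤ) := by exact_mod_cast Nat.odd_iff.mpr hqo
  have hr' : Odd (r : ℤ) := by exact_mod_cast Nat.odd_iff.mpr hro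
  have h225 : Odd (225 : ℤ) := by decide
  exact (((h225.mul hm').mul (hq'.pow)).mul hr'.pow)

/-- **Good reduction at `2`.** [folklore: Silverman AEC VII.1 Remark 1.1] -/
theorem hasGoodReductionAtPrime_two_family81517_model (hm : m.Prime) (hq : q.Prime) (hr : r.Prime)
    (hn : n ≠ 0) (hq_eq : (q : ℤ) = m + 64 * n ^ 2) (hr_eq : (r : ℤ) = m + 289 * n ^ 2)
    (hA : 4 * A = -17 * q - 1) :
    haveI := isGloballyMinimal_family81517_model hm hq hr hq_eq hr_eq hA
    (⟨1, (A : ℚ), 0, (((q : ℤ) * r : ℤ) : ℚ), 0⟩ : WeierstrassCurve ℚ).HasGoodReductionAtPrime 2 := by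
  haveI := isGloballyMinimal_family81517_model hm hq hr hq_eq hr_eq hA
  refine hasGoodReductionAtPrime_of_not_dvd _ 2 ?_
  rw [minimalDiscriminantInt_family81517_model hm hq hr hq_eq hr_eq hA]
  exact_mod_cast not_two_dvd_Δ_family81517 hm hq hr hn hq_eq hr_eq

/-- `y² + xy = x³ + ā x² + x` over `𝔽₂` has `2` points if `ā = 1` and `4` points if `ā = 0`; in
either case `3 − #` is odd. [folklore] -/
theorem natCard_point_F2_family81517 (a : ZMod 2) :
    Nat.card (⟨1, a, 0, 1, 0⟩ : WeierstrassCurve (ZMod 2)).toAffine.Point = 2 ∨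
      Nat.card (⟨1, a, 0, 1, 0⟩ : WeierstrassCurve (ZMod 2)).toAffine.Point = 4 := by
  fin_cases a
  · right; rw [natCard_point_eq_one_add_card _ (by decide)]; decide
  · left; rw [natCard_point_eq_one_add_card _ (by decide)]; decide

/-- The reduction of the integral model modulo `2` is `⟨1, ā, 0, 1, 0⟩` (`qr` odd). [folklore] -/
theorem family81517Int_map_zmod_two (hm : m.Prime) (hq : q.Prime) (hr : r.Prime) (hn : n ≠ 0)
    (hq_eq : (q : ℤ) = m + 64 * n ^ 2) (hr_eq : (r : ℤ) = m + 289 * n ^ 2) (A : ℤ) :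
    (⟨1, A, 0, (q : ℤ) * r, 0⟩ : WeierstrassCurve ℤ).map (Int.castRingHom (ZMod 2)) =
      ⟨1, (A : ZMod 2), 0, 1, 0⟩ := by
  obtain ⟨-, hqo, hro, -, -⟩ := family81517_odd hm hq hr hn hq_eq hr_eq
  have hq1 : (q : ZMod 2) = 1 := by rw [← ZMod.natCast_mod, hqo, Nat.cast_one]
  have hr1 : (r : ZMod 2) = 1 := by rw [← ZMod.natCast_mod, hro, Nat.cast_one]
  ext <;> simp [WeierstrassCurve.map, hq1, hr1]

/-- **Ordinary at `2`**: `a₂(W) = 3 − #W̃(𝔽₂) ∈ {1, −1}` is odd. [folklore] -/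
theorem not_two_dvd_frobeniusTrace_family81517_model (hm : m.Prime) (hq : q.Prime) (hr : r.Prime)
    (hn : n ≠ 0) (hq_eq : (q : ℤ) = m + 64 * n ^ 2) (hr_eq : (r : ℤ) = m + 289 * n ^ 2)
    (hA : 4 * A = -17 * q - 1) :
    haveI := isGloballyMinimal_family81517_model hm hq hr hq_eq hr_eq hA
    ¬ ((2 : ℕ) : ℤ) ∣ frobeniusTrace (⟨1, (A : ℚ), 0, (((q : ℤ) * r : ℤ) : ℚ), 0⟩ : WeierstrassCurve ℚ) 2 := by
  haveI := isGloballyMinimal_family81517_model hm hq hr hq_eq hr_eq hA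
  rw [frobeniusTrace, reductionPointCount, integralModelInt_family81517_model hm hq hr hq_eq hr_eq hA,
    family81517Int_map_zmod_two hm hq hr hn hq_eq hr_eq A]
  rcases natCard_point_F2_family81517 (A : ZMod 2) with h | h <;> rw [h] <;> norm_num

/-- **The `a₁ = 1` model of p2's family is good ordinary at `2`** (`IsOrdinaryAt`, for the minimality
instance above; the predicate is proof-irrelevant in the instance). [folklore] -/
theorem isOrdinaryAt_two_family81517_model (hm : m.Prime) (hq : q.Prime) (hr : r.Prime) (hn : n ≠ 0)
    (hq_eq : (q : ℤ) = m + 64 * n ^ 2) (hr_eq : (r : ℤ) = m + 289 * n ^ 2) (hA : 4 * A = -17 * q - 1) :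
    @IsOrdinaryAt (⟨1, (A : ℚ), 0, (((q : ℤ) * r : ℤ) : ℚ), 0⟩ : WeierstrassCurve ℚ)
      (isGloballyMinimal_family81517_model hm hq hr hq_eq hr_eq hA) 2 _ :=
  ⟨hasGoodReductionAtPrime_two_family81517_model hm hq hr hn hq_eq hr_eq hA,
    not_two_dvd_frobeniusTrace_family81517_model hm hq hr hn hq_eq hr_eq hA⟩

/-- The same, for ANY proof of global minimality (as p2's `FamilyFacts` quantifies it). [folklore] -/
theorem isOrdinaryAt_two_family81517_model' (hm : m.Prime) (hq : q.Prime) (hr : r.Prime) (hn : n ≠ 0)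
    (hq_eq : (q : ℤ) = m + 64 * n ^ 2) (hr_eq : (r : ℤ) = m + 289 * n ^ 2) (hA : 4 * A = -17 * q - 1)
    (hmin : (⟨1, (A : ℚ), 0, (((q : ℤ) * r : ℤ) : ℚ), 0⟩ : WeierstrassCurve ℚ).IsGloballyMinimal) :
    @IsOrdinaryAt (⟨1, (A : ℚ), 0, (((q : ℤ) * r : ℤ) : ℚ), 0⟩ : WeierstrassCurve ℚ) hmin 2 _ :=
  isOrdinaryAt_two_family81517_model hm hq hr hn hq_eq hr_eq hA

end Family81517AtTwo

/-! ### §4 (appendix) K_F1 assembled: p2's `FamilyFacts` shape, modulo the Modularity Theorem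

p2's sketch item reads `∀ j n, Admissible j n → ∃ (_ : IsElliptic) (hmin : IsGloballyMinimal),
IsOrdinaryAt 2 ∧ 2 ≤ mordellWeilRank ∧ ∃ N _ f, IsNewformOf (curve j n) f`. With `m = 8j + 3`,
`q = qOf j n`, `r = rOf j n`, `A = −34(j + 8n²) − 13` (so `4A = −17q − 1`) the curve `curve j n` is literally
`⟨1, A, 0, qr, 0⟩`, and every conjunct except the newform is a tree theorem of this file and its companion;
the newform is the Modularity Theorem, i.e. the tree's named fact `exists_isNewformOf` (Wiles, Taylor–Wiles,
BCDT), taken here as the hypothesis `hmod`. -/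

section Assembly

open Literature.NumberTheory.EllipticCurves.ModularForms

variable {m q r : ℕ} {n A : ℤ}

/-- **K_F1 for the `8-15-17` family, modulo Modularity.** For primes `m`, `q = m + 64n²`, `r = m + 289n²`
(`n ≠ 0`) and `4A = −17q − 1`, the model `W = ⟨1, A, 0, qr, 0⟩` is an elliptic curve, globally minimal,
good ordinary at `2`, of Mordell–Weil rank `≥ 2`, and (Modularity) has a weight-2 newform.
[folklore: assembled from this file, `TwoIsogenyPlantedRankKernel`, and the fact `exists_isNewformOf`] -/
theorem familyFacts81517 (hmod : exists_isNewformOf) (hm : m.Prime) (hq : q.Prime) (hr : r.Prime)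
    (hn : n ≠ 0) (hq_eq : (q : ℤ) = m + 64 * n ^ 2) (hr_eq : (r : ℤ) = m + 289 * n ^ 2)
    (hA : 4 * A = -17 * q - 1) :
    ∃ (_ : (⟨1, (A : ℚ), 0, (((q : ℤ) * r : ℤ) : ℚ), 0⟩ : WeierstrassCurve ℚ).IsElliptic)
      (hmin : (⟨1, (A : ℚ), 0, (((q : ℤ) * r : ℤ) : ℚ), 0⟩ : WeierstrassCurve ℚ).IsGloballyMinimal),
      @IsOrdinaryAt (⟨1, (A : ℚ), 0, (((q : ℤ) * r : ℤ) : ℚ), 0⟩ : WeierstrassCurve ℚ) hmin 2 _ ∧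
        2 ≤ (⟨1, (A : ℚ), 0, (((q : ℤ) * r : ℤ) : ℚ), 0⟩ : WeierstrassCurve ℚ).mordellWeilRank ∧
        ∃ (N : ℕ) (_ : NeZero N) (f : CuspForm (CongruenceSubgroup.Gamma0 N) 2),
          IsNewformOf (⟨1, (A : ℚ), 0, (((q : ℤ) * r : ℤ) : ℚ), 0⟩ : WeierstrassCurve ℚ) f := by
  set W : WeierstrassCurve ℚ := ⟨1, (A : ℚ), 0, (((q : ℤ) * r : ℤ) : ℚ), 0⟩ with hW
  haveI hE : W.IsElliptic := isElliptic_family81517_model (n := n) hm hq hr hq_eq hr_eq hA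
  have hmin : W.IsGloballyMinimal := isGloballyMinimal_family81517_model hm hq hr hq_eq hr_eq hA
  haveI : NeZero (W.conductorNorm ℤ) := ⟨(W.conductorNorm_pos_holds).ne'⟩
  obtain ⟨f, hf⟩ := hmod W
  exact ⟨hE, hmin, isOrdinaryAt_two_family81517_model' hm hq hr hn hq_eq hr_eq hA hmin,
    two_le_mordellWeilRank_family81517_model hm hq hr hn hq_eq hr_eq hA, _, inferInstance, f, hf⟩

end Assembly

end Summit.BirchSwinnertonDyer.Rank2
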